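import Summits.ABC.ABC.Theses.IsogenyGlueCongruence
import Literature.NumberTheory.Automorphic.BrandtXi
import Literature.NumberTheory.EllipticCurves.TakahashiDegreeFormula
import Literature.NumberTheory.DiophantineGeometry.PastenValuationProducts

/-!
# Strategist census signatures — crux B `PolyDegreeOfBoundedPrimes` (stmt-ABC-2046)

Typed forms of the statements named in `STRATEGY-CENSUS.md` (crux-strategist s1, 2026-08-17).
Definitions only (plus two one-line sanity implications); nothing here is a line or a stub.
-/

noncomputable section

set_option linter.dupNamespace false

namespace Summit.ABC.ABC.Cruxes.PolyDegreeOfBoundedPrimes.StrategistCensus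

open Summit.ABC.ABC.Theses.IsogenyGlueCongruence
open Literature.NumberTheory.EllipticCurves.ModularForms

/-- `P`: the polynomial modular-degree conjecture for semistable curves (consequent of B). -/
def PolyDegree : Prop :=
  ∃ κ C : ℝ, ∀ (W : WeierstrassCurve ℚ) [W.IsElliptic] [W.IsGloballyMinimal]
    [NeZero (W.conductorNorm ℤ)], W.IsSemistable ℤ →
    ∃ D : ModularParametrizationData W (W.conductorNorm ℤ),
      (D.modularDegree : ℝ) ≤ C * (W.conductorNorm ℤ : ℝ) ^ κ

/-- STRENGTHEN S⁺₁ = B with its hypothesis A dropped: literally `P`. -/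
def StrengthenDropA : Prop := PolyDegree

theorem b_of_strengthenDropA (h : StrengthenDropA) : PolyDegreeOfBoundedPrimes := fun _ => h

/-- STRENGTHEN S⁺₂ (fixed output exponent θ, one constant): refuted for every θ < 3/2
unconditionally and θ < 2 under `PeterssonLowerBound` (Disproof.lean §3, landed p82674). -/
def StrengthenFixedExponent (θ : ℝ) : Prop :=
  DegreePrimesPolyBounded → ∃ C : ℝ, ∀ (W : WeierstrassCurve ℚ) [W.IsElliptic] [W.IsGloballyMinimal]
    [NeZero (W.conductorNorm ℤ)], W.IsSemistable ℤ →
    ∃ D : ModularParametrizationData W (W.conductorNorm ℤ),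
      (D.modularDegree : ℝ) ≤ C * (W.conductorNorm ℤ : ℝ) ^ θ

theorem b_of_strengthenFixedExponent (θ : ℝ) (h : StrengthenFixedExponent θ) :
    PolyDegreeOfBoundedPrimes := fun hA => ⟨θ, h hA⟩

/-- DECOMPOSITION D2, piece (i): polynomial bound for the DEFINITE congruence number
`ξ(E; N/r, r)` (self-pairing of the primitive integral Jacquet–Langlands eigenvector in the Brandt
module of the definite quaternion algebra ramified at `r, ∞`) at every prime `r ∣ N`, for
semistable curves — route DefiniteXi's `XiBound` moved from Frey curves to all semistable curves. -/
def XiPolySemistable : Prop :=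
  ∃ κ C : ℝ, ∀ (W : WeierstrassCurve ℚ) [W.IsElliptic] [W.IsGloballyMinimal]
    [NeZero (W.conductorNorm ℤ)], W.IsSemistable ℤ → ∀ r : ℕ, r.Prime → r ∣ W.conductorNorm ℤ →
    (Literature.NumberTheory.Automorphic.brandtXi (W.conductorNorm ℤ / r) r
        (fun n => W.LFunction n) : ℝ) ≤ C * (W.conductorNorm ℤ : ℝ) ^ κ

/-- D2 (i) granted A — the relocated crux. -/
def XiPolySemistableOfBoundedPrimes : Prop := DegreePrimesPolyBounded → XiPolySemistable

/-- DECOMPOSITION D2, piece (ii): SOME multiplicative prime has a polynomially bounded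
discriminant exponent. KNOWN: Pasten–Shimura 2024 Thm 1.12 (`∏_{p∣N} v_p(Δ) < K_ε N^{11/2+ε}`,
tree fact `pasten_valuationProduct_semistable`) bounds even the geometric mean. -/
def MinValuationPoly : Prop :=
  ∃ κ C : ℝ, ∀ (W : WeierstrassCurve ℚ) [W.IsElliptic] [W.IsGloballyMinimal]
    [NeZero (W.conductorNorm ℤ)], W.IsSemistable ℤ → 1 < W.conductorNorm ℤ →
    ∃ r : ℕ, r.Prime ∧ r ∣ W.conductorNorm ℤ ∧
      (((W.minimalDiscriminantNorm ℤ).factorization r : ℕ) : ℝ) ≤ C * (W.conductorNorm ℤ : ℝ) ^ κ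

/-- DECOMPOSITION D2, piece (iii): Takahashi 2001 Thm 2.3 at one prime `r ∥ N` (tree named fact
`takahashi2001_thm_2_3_of_coprime`): `deg_min · i = ξ(N/r; r) · j` with `i · j = v_r(Δ_min)`,
so `deg_min ≤ ξ · v_r(Δ_min)`. -/
def TakahashiOnePrime : Prop := Literature.NumberTheory.EllipticCurves.takahashi2001_thm_2_3_of_coprime

/-- DECOMPOSITION D3 (arithmetic factorisation of the degree along primes ℓ): the ℓ-primary
part of the minimal modular degree is polynomially bounded, prime by prime ("DEPTH₁"). A
consequence of P; open for every single ℓ (even ℓ = 2). -/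
def PrimewiseDepthPoly : Prop :=
  ∃ κ C : ℝ, ∀ (W : WeierstrassCurve ℚ) [W.IsElliptic] [W.IsGloballyMinimal]
    [NeZero (W.conductorNorm ℤ)], W.IsSemistable ℤ →
    ∃ D : ModularParametrizationData W (W.conductorNorm ℤ), ∀ ℓ : ℕ, ℓ.Prime →
      ((ℓ ^ (D.modularDegree.factorization ℓ) : ℕ) : ℝ) ≤ C * (W.conductorNorm ℤ : ℝ) ^ κ

/-- D3, second piece: the log-radical of the modular degree is logarithmic ("COUNT": few
congruence primes in log-mass). A consequence of P; open; A bounds each summand only. -/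
def RadicalDegreePoly : Prop :=
  ∃ κ C : ℝ, ∀ (W : WeierstrassCurve ℚ) [W.IsElliptic] [W.IsGloballyMinimal]
    [NeZero (W.conductorNorm ℤ)], W.IsSemistable ℤ →
    ∃ D : ModularParametrizationData W (W.conductorNorm ℤ),
      ((D.modularDegree.primeFactors.prod id : ℕ) : ℝ) ≤ C * (W.conductorNorm ℤ : ℝ) ^ κ

end Summit.ABC.ABC.Cruxes.PolyDegreeOfBoundedPrimes.StrategistCensus
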